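import Summits.ValiantsHypothesis.Statement
import Literature.Computability.AlgebraicComplexity.RealTauConjectureDepthFour
import Literature.Computability.AlgebraicComplexity.RazElusiveGeneralProofs
import Literature.Computability.AlgebraicComplexity.RazElusiveGeneralRouteProofs
import Literature.Computability.AlgebraicComplexity.StandardFamilies

/-!
# TwoAdicLadder — crux `PrecisionLadder` (stmt-ValiantsHypothesis-5948), line `birth`,
# registered stub `stub_ladderZ`: CALIBRATION I (route-independent part: what the stub implies)

Route `ValiantsHypothesis/TwoAdicLadder`, crux `PrecisionLadder`, registered line
`Cruxes/PrecisionLadder/Lines/birth.lean`, load-bearing OPEN stub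

  `stub_ladderZ : ∀ c, ∃ᶠ n in atTop, ∃ k, n ^ c < complexity (perPoly (Fin n) (ZMod (2 ^ (k + 1))))`

("the exponent of the permanent over the PRIME rings `ℤ/2^(k+1)` is unbounded in the precision").
The stub statement is used VERBATIM below (spelled out; no local definition; this file imports no
route file). Recorded here, kernel-checked:

* `not_isPBounded_iff_frequently_lt` — the dictionary between the exponent form
  `∀ c, ∃ᶠ n, n^c < t n` used by the route and `¬ IsPBounded t` (Bürgisser's p-boundedness).
* `complexity_perPoly_zmod_mono`, `ladderZ_iff_eventually_precision` — the ladder is MONOTONE in the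
  modulus (reduction `ℤ/b → ℤ/a`, `a ∣ b`, is free), so "`∃ k`" in the stub may be read "for all
  large `k`".
* `not_isPComputable_perPoly_int_of_ladderZ`, `not_isPBounded_tau_perPoly_of_ladderZ` — **stub ⇒ the
  permanent is not p-computable over `ℤ` (integer constants free) ⇒ `τ(per_n)` is not p-bounded**,
  i.e. the negative answer to Koiran's question (arXiv:1004.4960 §1), the consequent of route
  TauConst's crux; hence `valiantsHypothesis_of_ladderZ_of_tauConstElim` — **stub ∧ TauConstElim ⇒
  VH** (stmt-ValiantsHypothesis-0335, statement taken verbatim as a hypothesis): granted constant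
  elimination, the prime-ring ladder alone closes the summit, replacing both
  `TwoIntegralNormalisation` and `stub_descent` of this route.

The route-dependent half (crux ⇒ stub, VH ⇒ stub, witness precision → ∞ by `CeilingAllPrecisions`)
is in `…LadderZOfVH.lean`; the relocation `stub ⟺ per ∉ VP_{ℤ₂}` in `…LadderZTwoAdic.lean`.

Honest framing (rung currency): NO rung of the stub is proved here and none is claimed; the stub is
open-problem grade — proving it proves `τ(PER)` super-polynomial (Koiran/Bürgisser τ-territory),
refuting it refutes VH. `VP ≠ VNP` is NOT proved and nothing here is progress on it. No new
definitions, no named facts, no sorry.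

## References

* P. Bürgisser, *Completeness and Reduction in Algebraic Complexity Theory* (2000), Def. 2.1, §4.1
  (extension of scalars). [cite: Burgisser2000, §4.1]
* P. Koiran, *Shallow circuits with high-powered inputs*, arXiv:1004.4960, §1 (is `τ(PER_n)`
  polynomially bounded?). [cite: Koiran2004, §1]
-/

noncomputable section

open MvPolynomial

-- the summit and the problem share the name `ValiantsHypothesis` (D-0017 single-conjunct layout)
set_option linter.dupNamespace false

namespace Summit.ValiantsHypothesis.ValiantsHypothesis.Theorems.TwoAdicLadderPrecisionLadder

open Filter Literature.Computability.AlgebraicComplexity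

/-! ### §0. Exponent form versus p-boundedness -/

/-- **Dictionary.** `t` is not p-bounded (`¬ ∃ c, ∀ n, t n ≤ n^c + c`) iff for every exponent `c`,
`n ^ c < t n` for infinitely many `n` (the "exponent form" in which the route states its items).
(`→`: otherwise `t ≤ n^c` eventually, and finitely many exceptions are absorbed by
`IsPBounded.of_eventually_le`; `←`: `n^a + a ≤ n^(a+1)` for `n ≥ a + 1`.) [cite: Burgisser2000, Def. 2.1(1)] -/
theorem not_isPBounded_iff_frequently_lt (t : ℕ → ℕ) :
    ¬ IsPBounded t ↔ ∀ c : ℕ, ∃ᶠ n in atTop, n ^ c < t n := by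
  constructor
  · intro h c
    by_contra hc
    rw [not_frequently, eventually_atTop] at hc
    obtain ⟨n₀, hn₀⟩ := hc
    refine h (IsPBounded.of_eventually_le (t := fun n => n ^ c) n₀ ⟨c, fun n => Nat.le_add_right _ _⟩ ?_)
    intro n hn
    exact not_lt.1 (hn₀ n hn)
  · rintro h ⟨a, ha⟩
    have hev : ∀ᶠ n in atTop, n ^ a + a ≤ n ^ (a + 1) := by
      filter_upwards [eventually_ge_atTop (a + 1)] with n hn
      have hpos : 0 < n ^ a := pow_pos (by omega) a
      have h1 : a ≤ a * n ^ a := Nat.le_mul_of_pos_right a hpos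
      calc n ^ a + a ≤ n ^ a + a * n ^ a := by omega
        _ = (a + 1) * n ^ a := by ring
        _ ≤ n * n ^ a := Nat.mul_le_mul_right _ hn
        _ = n ^ (a + 1) := by ring
    obtain ⟨n, hlt, hle⟩ := ((h (a + 1)).and_eventually hev).exists
    exact absurd (hlt.trans_le ((ha n).trans hle)) (lt_irrefl _)

/-- The same dictionary for families of polynomials: `f` is not p-computable iff for every `c`,
`n ^ c < L(f_n)` infinitely often. [cite: Burgisser2000, Def. 2.2] -/
theorem not_isPComputable_iff_frequently_lt {R : Type*} [CommSemiring R] {σ : ℕ → Type*}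
    (f : ∀ n, MvPolynomial (σ n) R) :
    ¬ IsPComputable f ↔ ∀ c : ℕ, ∃ᶠ n in atTop, n ^ c < complexity (f n) :=
  not_isPBounded_iff_frequently_lt _

/-! ### §1. Monotonicity in the modulus: the ladder is a ladder -/

/-- **Reduction is free.** For `a ∣ b`, `L_{ℤ/a}(per_n) ≤ L_{ℤ/b}(per_n)`: push a circuit along the
reduction map `ℤ/b → ℤ/a` (`ZMod.castHom`; extension of scalars `ArithCircuit.complexity_map_le`,
`map_perPoly`). [cite: Burgisser2000, §4.1] -/
theorem complexity_perPoly_zmod_mono (n : ℕ) {a b : ℕ} (h : a ∣ b) :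
    complexity (perPoly (Fin n) (ZMod a)) ≤ complexity (perPoly (Fin n) (ZMod b)) := by
  have hle := ArithCircuit.complexity_map_le (ZMod.castHom h (ZMod a)) (perPoly (Fin n) (ZMod b))
  rwa [map_perPoly] at hle

/-- The `2`-adic ladder is monotone in the precision: `k ≤ l ⇒ L_{ℤ/2^k}(per_n) ≤ L_{ℤ/2^l}(per_n)`.
[cite: Burgisser2000, §4.1] -/
theorem complexity_perPoly_zmod_two_pow_mono (n : ℕ) {k l : ℕ} (h : k ≤ l) :
    complexity (perPoly (Fin n) (ZMod (2 ^ k))) ≤ complexity (perPoly (Fin n) (ZMod (2 ^ l))) :=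
  complexity_perPoly_zmod_mono n (pow_dvd_pow 2 h)

/-- Integer constants are at least as good as constants modulo `m`:
`L_{ℤ/m}(per_n) ≤ L_ℤ(per_n)`. [cite: Burgisser2000, §4.1] -/
theorem complexity_perPoly_zmod_le_int (n m : ℕ) :
    complexity (perPoly (Fin n) (ZMod m)) ≤ complexity (perPoly (Fin n) ℤ) := by
  have hle := ArithCircuit.complexity_map_le (Int.castRingHom (ZMod m)) (perPoly (Fin n) ℤ)
  rwa [map_perPoly] at hle

/-- **"Some precision" = "every large precision".** By monotonicity the stub is equivalent to:
for every `c`, for infinitely many `n`, `n ^ c < L_{ℤ/2^(k+1)}(per_n)` for ALL sufficiently large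
`k`. [folklore] -/
theorem ladderZ_iff_eventually_precision :
    (∀ c : ℕ, ∃ᶠ n in atTop, ∃ k : ℕ,
        n ^ c < complexity (perPoly (Fin n) (ZMod (2 ^ (k + 1))))) ↔
      ∀ c : ℕ, ∃ᶠ n in atTop, ∀ᶠ k in atTop,
        n ^ c < complexity (perPoly (Fin n) (ZMod (2 ^ (k + 1)))) := by
  refine forall_congr' fun c => ⟨fun h => h.mono ?_, fun h => h.mono ?_⟩
  · rintro n ⟨k, hk⟩
    exact eventually_atTop.2 ⟨k, fun l hl =>
      hk.trans_le (complexity_perPoly_zmod_two_pow_mono n (by omega))⟩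
  · intro n hn
    exact hn.exists

/-! ### §2. The stub is above Koiran's question (and above `per ∉ VP_ℤ`) -/

/-- **Stub ⇒ the permanent is not p-computable over `ℤ`** (circuits with arbitrary integer
constants, each counted as one operand): a polynomial-size integer circuit would reduce modulo every
`2^(k+1)` (`complexity_perPoly_zmod_le_int`). [cite: Burgisser2000, §4.1] -/
theorem not_isPComputable_perPoly_int_of_ladderZ
    (hZ : ∀ c : ℕ, ∃ᶠ n in atTop, ∃ k : ℕ,
      n ^ c < complexity (perPoly (Fin n) (ZMod (2 ^ (k + 1))))) :
    ¬ IsPComputable (fun n => perPoly (Fin n) ℤ) := by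
  rw [not_isPComputable_iff_frequently_lt]
  intro c
  refine (hZ c).mono ?_
  rintro n ⟨k, hk⟩
  exact hk.trans_le (complexity_perPoly_zmod_le_int n _)

/-- **Stub ⇒ `τ(per_n)` is not p-bounded** — the negative answer to Koiran's question "is the
constant-free complexity of the permanent polynomially bounded?" (arXiv:1004.4960 §1), in the tree's
standard phrasing `¬ IsPBounded (fun n => constantFreeComplexity (perPoly (Fin n) ℤ))` (the
consequent of route TauConst's crux `TauConstElim`): a constant-free circuit reduces modulo `2^(k+1)`
at no cost (tree `ArithCircuit.complexity_map_le_constantFreeComplexity`; the per-instance is the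
tree's `GaugeDescent.DescentGlue.complexity_perPoly_zmod_le_constantFree`, re-derived inline to keep
this file outside that route's import cone). So the stub is at least as hard to PROVE as that named
open problem. [cite: Koiran2004, §1] -/
theorem not_isPBounded_tau_perPoly_of_ladderZ
    (hZ : ∀ c : ℕ, ∃ᶠ n in atTop, ∃ k : ℕ,
      n ^ c < complexity (perPoly (Fin n) (ZMod (2 ^ (k + 1))))) :
    ¬ IsPBounded (fun n => constantFreeComplexity (perPoly (Fin n) ℤ)) := by
  rw [not_isPBounded_iff_frequently_lt]
  intro c
  refine (hZ c).mono ?_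
  rintro n ⟨k, hk⟩
  refine hk.trans_le ?_
  rw [← map_perPoly (Int.castRingHom (ZMod (2 ^ (k + 1))))]
  exact ArithCircuit.complexity_map_le_constantFreeComplexity _ _

/-- **Stub ∧ TauConstElim ⇒ VH.** Hypothesis `hτ` is the statement of route TauConst's crux
`TauConstElim` (stmt-ValiantsHypothesis-0335: "`VP_ℂ = VNP_ℂ →` `τ(per_n)` is p-bounded", a named
open problem — constant elimination) verbatim; no second route file is imported. Granted it, the
prime-ring ladder ALONE closes the summit: the stub replaces both `TwoIntegralNormalisation` and
`stub_descent` of this route. Calibration only: neither hypothesis is proved and `VP ≠ VNP` is NOT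
proved here. [cite: Burgisser2000, §4.1] -/
theorem valiantsHypothesis_of_ladderZ_of_tauConstElim
    (hZ : ∀ c : ℕ, ∃ᶠ n in atTop, ∃ k : ℕ,
      n ^ c < complexity (perPoly (Fin n) (ZMod (2 ^ (k + 1)))))
    (hτ : VP ℂ = VNP ℂ → IsPBounded (fun n => constantFreeComplexity (perPoly (Fin n) ℤ))) :
    ValiantsHypothesis := by
  unfold ValiantsHypothesis Literature.PNP.ValiantHypothesis
  intro hEq
  exact not_isPBounded_tau_perPoly_of_ladderZ hZ (hτ hEq)

end Summit.ValiantsHypothesis.ValiantsHypothesis.Theorems.TwoAdicLadderPrecisionLadder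

end
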